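import Summits.AtomisticToContinuum.Crystallization.Theorems.ExcessDecayLiouvilleCaccioppoliLocalWeights

/-!
# Route `ExcessDecayLiouville`: the LOCALISED Caccioppoli bound (assembly)

Second half of the localised cutoff bound (step (c2), `k ≥ 2`, of the energy route for item `ExcessDecay`,
stmt-AtomisticToContinuum-9334): the four double sums of the near/far majorants of
`ExcessDecayLiouvilleCaccioppoliLocalWeights.lean` are evaluated (`tsum_tsum_nearWeight(')_le`,
`tsum_tsum_farWeight(')_le`) and assembled into

`|½ Σ'Σ' [p≠q] (η_p − η_q)² ⟪K(p−q) h_p, h_q⟫| ≤ (19·C₆/ρ²) Σ'_p ‖h p‖²·𝟙[dist p c ≤ R+ρ] + 38·(1024/((23/25)³ρ⁵))·B²·(2R/(23/25)+1)³`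

(`abs_cutoffForm_le_local`).  All `[folklore]`; helper lemmas, nothing here closes an item.
-/

noncomputable section

namespace Summit.AtomisticToContinuum.Crystallization.Theorems.ExcessDecayLiouville

open scoped BigOperators Topology InnerProductSpace RealInnerProductSpace Classical
open Literature.MathematicalPhysics.StatisticalMechanics
open Summit.AtomisticToContinuum.Crystallization.Theorems.PhononStabilityNegative

section

variable {t : Fin 2 → (EuclideanSpace ℝ (Fin 3))} {A : (EuclideanSpace ℝ (Fin 3)) →L[ℝ] (EuclideanSpace ℝ (Fin 3))}

/-- Near part (i): `Σ'Σ' [q≠p] |q−p|⁻⁶ ‖h p‖² 𝟙_N(p) ≤ C₆ · Σ' ‖h p‖² 𝟙_N(p)`. [folklore] -/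
theorem tsum_tsum_nearWeight'_le (hA : Adm₀ A) (hI : Inner₀ t A) {h : (EuclideanSpace ℝ (Fin 3)) → (EuclideanSpace ℝ (Fin 3))}
    (hh : (Function.support h).Finite) (c : (EuclideanSpace ℝ (Fin 3))) (R ρ : ℝ) :
    (∑' p : Sites₀ t A, ∑' q : Sites₀ t A, (if (q : (EuclideanSpace ℝ (Fin 3))) ≠ p then (dist (q : (EuclideanSpace ℝ (Fin 3))) p)⁻¹ ^ 6 * (‖h p‖ ^ 2 * (if dist (p : (EuclideanSpace ℝ (Fin 3))) c ≤ R + ρ then (1 : ℝ) else 0)) else 0)) ≤ (1024 / ((23 / 25 : ℝ) ^ 3 * (23 / 25 : ℝ) ^ 3)) * ∑' p : Sites₀ t A, ‖h p‖ ^ 2 * (if dist (p : (EuclideanSpace ℝ (Fin 3))) c ≤ R + ρ then (1 : ℝ) else 0) := by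
  classical
  have hWn := summable_nearWeight hA hI hh c R ρ
  have hWn' : Summable (Function.uncurry fun (p q : Sites₀ t A) => (if (q : (EuclideanSpace ℝ (Fin 3))) ≠ p then (dist (q : (EuclideanSpace ℝ (Fin 3))) p)⁻¹ ^ 6 * (‖h p‖ ^ 2 * (if dist (p : (EuclideanSpace ℝ (Fin 3))) c ≤ R + ρ then (1 : ℝ) else 0)) else 0)) := by
    refine hWn.prod_symm.congr fun pq => ?_
    obtain ⟨p, q⟩ := pq
    simp only [Prod.swap_prod_mk, Function.uncurry_apply_pair]
  have hout : Summable (fun p : Sites₀ t A => ∑' q : Sites₀ t A, (if (q : (EuclideanSpace ℝ (Fin 3))) ≠ p then (dist (q : (EuclideanSpace ℝ (Fin 3))) p)⁻¹ ^ 6 * (‖h p‖ ^ 2 * (if dist (p : (EuclideanSpace ℝ (Fin 3))) c ≤ R + ρ then (1 : ℝ) else 0)) else 0)) := hWn'.prod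
  have hloc_s : Summable (fun p : Sites₀ t A => ‖h p‖ ^ 2 * (if dist (p : (EuclideanSpace ℝ (Fin 3))) c ≤ R + ρ then (1 : ℝ) else 0)) := by
    refine summable_of_ne_finset_zero (s := (finite_support_sites (t := t) (A := A) hh).toFinset) ?_
    intro p hp
    have hvp : h p = 0 := by
      by_contra h'
      exact hp ((Set.Finite.mem_toFinset _).2 h')
    simp [hvp]
  rw [← tsum_mul_left]
  refine hout.tsum_le_tsum (fun p => ?_) (hloc_s.mul_left _)
  have hrow : (∑' q : Sites₀ t A, (if (q : (EuclideanSpace ℝ (Fin 3))) ≠ p then (dist (q : (EuclideanSpace ℝ (Fin 3))) p)⁻¹ ^ 6 * (‖h p‖ ^ 2 * (if dist (p : (EuclideanSpace ℝ (Fin 3))) c ≤ R + ρ then (1 : ℝ) else 0)) else 0)) =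
      (∑' q : Sites₀ t A, (if (q : (EuclideanSpace ℝ (Fin 3))) ≠ p then (dist (q : (EuclideanSpace ℝ (Fin 3))) p)⁻¹ ^ 6 else 0)) * (‖h p‖ ^ 2 * (if dist (p : (EuclideanSpace ℝ (Fin 3))) c ≤ R + ρ then (1 : ℝ) else 0)) := by
    rw [← tsum_mul_right]
    refine tsum_congr fun q => ?_
    by_cases hqp : (q : (EuclideanSpace ℝ (Fin 3))) = p
    · rw [if_neg (fun h' => h' hqp), if_neg (fun h' => h' hqp), zero_mul]
    · rw [if_pos hqp, if_pos hqp]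
  rw [hrow]
  exact mul_le_mul_of_nonneg_right (tsum_inv_pow_six_sites_le hA hI p.2) (by split_ifs <;> positivity)

/-- Near part (ii): `Σ'Σ' [p≠q] |p−q|⁻⁶ ‖h q‖² 𝟙_N(q) ≤ C₆ · Σ' ‖h q‖² 𝟙_N(q)` (swap the order of summation). [folklore] -/
theorem tsum_tsum_nearWeight_le (hA : Adm₀ A) (hI : Inner₀ t A) {h : (EuclideanSpace ℝ (Fin 3)) → (EuclideanSpace ℝ (Fin 3))}
    (hh : (Function.support h).Finite) (c : (EuclideanSpace ℝ (Fin 3))) (R ρ : ℝ) :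
    (∑' p : Sites₀ t A, ∑' q : Sites₀ t A, (if (p : (EuclideanSpace ℝ (Fin 3))) ≠ q then (dist (p : (EuclideanSpace ℝ (Fin 3))) q)⁻¹ ^ 6 * (‖h q‖ ^ 2 * (if dist (q : (EuclideanSpace ℝ (Fin 3))) c ≤ R + ρ then (1 : ℝ) else 0)) else 0)) ≤ (1024 / ((23 / 25 : ℝ) ^ 3 * (23 / 25 : ℝ) ^ 3)) * ∑' q : Sites₀ t A, ‖h q‖ ^ 2 * (if dist (q : (EuclideanSpace ℝ (Fin 3))) c ≤ R + ρ then (1 : ℝ) else 0) := by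
  classical
  have hWn := summable_nearWeight hA hI hh c R ρ
  rw [← hWn.tsum_comm]
  have hout' : Summable (fun q : Sites₀ t A => ∑' p : Sites₀ t A, (if (p : (EuclideanSpace ℝ (Fin 3))) ≠ q then (dist (p : (EuclideanSpace ℝ (Fin 3))) q)⁻¹ ^ 6 * (‖h q‖ ^ 2 * (if dist (q : (EuclideanSpace ℝ (Fin 3))) c ≤ R + ρ then (1 : ℝ) else 0)) else 0)) := hWn.prod_symm.prod
  have hloc_s : Summable (fun q : Sites₀ t A => ‖h q‖ ^ 2 * (if dist (q : (EuclideanSpace ℝ (Fin 3))) c ≤ R + ρ then (1 : ℝ) else 0)) := by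
    refine summable_of_ne_finset_zero (s := (finite_support_sites (t := t) (A := A) hh).toFinset) ?_
    intro q hq
    have hvq : h q = 0 := by
      by_contra h'
      exact hq ((Set.Finite.mem_toFinset _).2 h')
    simp [hvq]
  rw [← tsum_mul_left]
  refine hout'.tsum_le_tsum (fun q => ?_) (hloc_s.mul_left _)
  have hrow : (∑' p : Sites₀ t A, (if (p : (EuclideanSpace ℝ (Fin 3))) ≠ q then (dist (p : (EuclideanSpace ℝ (Fin 3))) q)⁻¹ ^ 6 * (‖h q‖ ^ 2 * (if dist (q : (EuclideanSpace ℝ (Fin 3))) c ≤ R + ρ then (1 : ℝ) else 0)) else 0)) =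
      (∑' p : Sites₀ t A, (if (p : (EuclideanSpace ℝ (Fin 3))) ≠ q then (dist (p : (EuclideanSpace ℝ (Fin 3))) q)⁻¹ ^ 6 else 0)) * (‖h q‖ ^ 2 * (if dist (q : (EuclideanSpace ℝ (Fin 3))) c ≤ R + ρ then (1 : ℝ) else 0)) := by
    rw [← tsum_mul_right]
    refine tsum_congr fun p => ?_
    by_cases hpq : (p : (EuclideanSpace ℝ (Fin 3))) = q
    · rw [if_neg (fun h' => h' hpq), if_neg (fun h' => h' hpq), zero_mul]
    · rw [if_pos hpq, if_pos hpq]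
  rw [hrow]
  exact mul_le_mul_of_nonneg_right (tsum_inv_pow_six_sites_le hA hI q.2) (by split_ifs <;> positivity)

/-- Far part (iii): `Σ'Σ' [p≠q][ρ<|p−q|] |p−q|⁻⁸ 𝟙_B(p) ≤ F₈ · P(R)`, `F₈ = 1024/((23/25)³ρ⁵)`, `P(R) = (2R/(23/25)+1)³`.
[folklore] -/
theorem tsum_tsum_farWeight_le (hA : Adm₀ A) (hI : Inner₀ t A) (c : (EuclideanSpace ℝ (Fin 3))) {R ρ : ℝ} (hR : 0 ≤ R)
    (hρ : 23 / 25 ≤ ρ) :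
    (∑' p : Sites₀ t A, ∑' q : Sites₀ t A, (if (p : (EuclideanSpace ℝ (Fin 3))) ≠ q then (if ρ < dist (p : (EuclideanSpace ℝ (Fin 3))) q then (dist (p : (EuclideanSpace ℝ (Fin 3))) q)⁻¹ ^ 8 else 0) * (if dist (p : (EuclideanSpace ℝ (Fin 3))) c ≤ R then (1 : ℝ) else 0) else 0)) ≤
      1024 / ((23 / 25 : ℝ) ^ 3 * ρ ^ 5) * (2 * R / (23 / 25) + 1) ^ 3 := by
  classical
  have hWf := summable_farWeight hA hI c R hρ
  obtain ⟨hIs, hIle⟩ := tsum_indicator_ball_sites_le hA hI c hR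
  have hrow : ∀ p : Sites₀ t A, (∑' q : Sites₀ t A, (if (p : (EuclideanSpace ℝ (Fin 3))) ≠ q then (if ρ < dist (p : (EuclideanSpace ℝ (Fin 3))) q then (dist (p : (EuclideanSpace ℝ (Fin 3))) q)⁻¹ ^ 8 else 0) * (if dist (p : (EuclideanSpace ℝ (Fin 3))) c ≤ R then (1 : ℝ) else 0) else 0)) ≤ 1024 / ((23 / 25 : ℝ) ^ 3 * ρ ^ 5) * (if dist (p : (EuclideanSpace ℝ (Fin 3))) c ≤ R then (1 : ℝ) else 0) := by
    intro p
    obtain ⟨hfs, hfle⟩ := summable_far_inv_pow_eight_sites hA hI (p : (EuclideanSpace ℝ (Fin 3))) hρ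
    have hle : (∑' q : Sites₀ t A, (if (p : (EuclideanSpace ℝ (Fin 3))) ≠ q then (if ρ < dist (p : (EuclideanSpace ℝ (Fin 3))) q then (dist (p : (EuclideanSpace ℝ (Fin 3))) q)⁻¹ ^ 8 else 0) * (if dist (p : (EuclideanSpace ℝ (Fin 3))) c ≤ R then (1 : ℝ) else 0) else 0)) ≤
        (∑' q : Sites₀ t A, (if ρ < dist (q : (EuclideanSpace ℝ (Fin 3))) p then (dist (q : (EuclideanSpace ℝ (Fin 3))) p)⁻¹ ^ 8 else 0)) * (if dist (p : (EuclideanSpace ℝ (Fin 3))) c ≤ R then (1 : ℝ) else 0) := by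
      rw [← tsum_mul_right]
      refine (hWf.prod_factor p).tsum_le_tsum (fun q => ?_) (hfs.mul_right _)
      have h0 : (0 : ℝ) ≤ (if dist (p : (EuclideanSpace ℝ (Fin 3))) c ≤ R then (1 : ℝ) else 0) := by split_ifs <;> norm_num
      by_cases hpq : (p : (EuclideanSpace ℝ (Fin 3))) = q
      · rw [if_neg (fun h' => h' hpq)]
        have : 0 ≤ (if ρ < dist (q : (EuclideanSpace ℝ (Fin 3))) p then (dist (q : (EuclideanSpace ℝ (Fin 3))) p)⁻¹ ^ 8 else 0) := by split_ifs <;> positivity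
        positivity
      · rw [if_pos hpq, dist_comm (q : (EuclideanSpace ℝ (Fin 3))) p]
    refine hle.trans ?_
    exact mul_le_mul_of_nonneg_right hfle (by split_ifs <;> norm_num)
  calc (∑' p : Sites₀ t A, ∑' q : Sites₀ t A, (if (p : (EuclideanSpace ℝ (Fin 3))) ≠ q then (if ρ < dist (p : (EuclideanSpace ℝ (Fin 3))) q then (dist (p : (EuclideanSpace ℝ (Fin 3))) q)⁻¹ ^ 8 else 0) * (if dist (p : (EuclideanSpace ℝ (Fin 3))) c ≤ R then (1 : ℝ) else 0) else 0))
      ≤ ∑' p : Sites₀ t A, 1024 / ((23 / 25 : ℝ) ^ 3 * ρ ^ 5) * (if dist (p : (EuclideanSpace ℝ (Fin 3))) c ≤ R then (1 : ℝ) else 0) := hWf.prod.tsum_le_tsum hrow (hIs.mul_left _)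
    _ = 1024 / ((23 / 25 : ℝ) ^ 3 * ρ ^ 5) * ∑' p : Sites₀ t A, (if dist (p : (EuclideanSpace ℝ (Fin 3))) c ≤ R then (1 : ℝ) else 0) := tsum_mul_left
    _ ≤ 1024 / ((23 / 25 : ℝ) ^ 3 * ρ ^ 5) * (2 * R / (23 / 25) + 1) ^ 3 :=
        mul_le_mul_of_nonneg_left hIle (by positivity)

/-- Far part (iv): the swapped far family has the same bound (swap the order of summation). [folklore] -/
theorem tsum_tsum_farWeight'_le (hA : Adm₀ A) (hI : Inner₀ t A) (c : (EuclideanSpace ℝ (Fin 3))) {R ρ : ℝ} (hR : 0 ≤ R)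
    (hρ : 23 / 25 ≤ ρ) :
    (∑' p : Sites₀ t A, ∑' q : Sites₀ t A, (if (q : (EuclideanSpace ℝ (Fin 3))) ≠ p then (if ρ < dist (q : (EuclideanSpace ℝ (Fin 3))) p then (dist (q : (EuclideanSpace ℝ (Fin 3))) p)⁻¹ ^ 8 else 0) * (if dist (q : (EuclideanSpace ℝ (Fin 3))) c ≤ R then (1 : ℝ) else 0) else 0)) ≤
      1024 / ((23 / 25 : ℝ) ^ 3 * ρ ^ 5) * (2 * R / (23 / 25) + 1) ^ 3 := by
  classical
  have hWf := summable_farWeight hA hI c R hρ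
  have hWf' : Summable (Function.uncurry fun (p q : Sites₀ t A) => (if (q : (EuclideanSpace ℝ (Fin 3))) ≠ p then (if ρ < dist (q : (EuclideanSpace ℝ (Fin 3))) p then (dist (q : (EuclideanSpace ℝ (Fin 3))) p)⁻¹ ^ 8 else 0) * (if dist (q : (EuclideanSpace ℝ (Fin 3))) c ≤ R then (1 : ℝ) else 0) else 0)) := by
    refine hWf.prod_symm.congr fun pq => ?_
    obtain ⟨p, q⟩ := pq
    simp only [Prod.swap_prod_mk, Function.uncurry_apply_pair]
  have hcomm : (∑' p : Sites₀ t A, ∑' q : Sites₀ t A, (if (q : (EuclideanSpace ℝ (Fin 3))) ≠ p then (if ρ < dist (q : (EuclideanSpace ℝ (Fin 3))) p then (dist (q : (EuclideanSpace ℝ (Fin 3))) p)⁻¹ ^ 8 else 0) * (if dist (q : (EuclideanSpace ℝ (Fin 3))) c ≤ R then (1 : ℝ) else 0) else 0)) = ∑' q : Sites₀ t A, ∑' p : Sites₀ t A, (if (q : (EuclideanSpace ℝ (Fin 3))) ≠ p then (if ρ < dist (q : (EuclideanSpace ℝ (Fin 3))) p then (dist (q : (EuclideanSpace ℝ (Fin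 3))) p)⁻¹ ^ 8 else 0) * (if dist (q : (EuclideanSpace ℝ (Fin 3))) c ≤ R then (1 : ℝ) else 0) else 0) :=
    (hWf'.tsum_comm).symm
  rw [hcomm]
  -- after renaming the bound variables this is literally part (iii)
  exact tsum_tsum_farWeight_le hA hI c hR hρ

/-- **Localised Caccioppoli bound** (see the module docstring). [folklore] -/
theorem abs_cutoffForm_le_local (hA : Adm₀ A) (hI : Inner₀ t A) {h : (EuclideanSpace ℝ (Fin 3)) → (EuclideanSpace ℝ (Fin 3))}
    (hh : (Function.support h).Finite) {B : ℝ} (hB : ∀ x, ‖h x‖ ≤ B)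
    {η : (EuclideanSpace ℝ (Fin 3)) → ℝ} (hη0 : ∀ x, 0 ≤ η x) (hη1 : ∀ x, η x ≤ 1)
    {c : (EuclideanSpace ℝ (Fin 3))} {R ρ : ℝ} (hρ : 1 ≤ ρ) (hR : 0 ≤ R)
    (hηR : ∀ p : Sites₀ t A, R < dist (p : (EuclideanSpace ℝ (Fin 3))) c → η p = 0)
    (hlip : ∀ p q : Sites₀ t A, |η p - η q| ≤ ‖(p : (EuclideanSpace ℝ (Fin 3))) - q‖ / ρ) :
    |(1 / 2 : ℝ) * ∑' p : Sites₀ t A, ∑' q : Sites₀ t A, (if (p : (EuclideanSpace ℝ (Fin 3))) ≠ q then (η p - η q) ^ 2 * ⟪((-((‖(p : (EuclideanSpace ℝ (Fin 3))) - q‖ ^ 2)⁻¹) ^ 7 + ((‖(p : (EuclideanSpace ℝ (Fin 3))) - q‖ ^ 2)⁻¹) ^ 4) • (h p) + (2 * ⟪(p : (EuclideanSpace ℝ (Fin 3))) - q, h p⟫ * (7 * ((‖(p : (EuclideanSpace ℝ (Fin 3))) - q‖ ^ 2)⁻¹) ^ 8 - 4 * ((‖(p : (EuclideanSpace ℝ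 (Fin 3))) - q‖ ^ 2)⁻¹) ^ 5)) • ((p : (EuclideanSpace ℝ (Fin 3))) - q)), h q⟫ else 0)| ≤
      19 * (1024 / ((23 / 25 : ℝ) ^ 3 * (23 / 25 : ℝ) ^ 3)) / ρ ^ 2 * (∑' p : Sites₀ t A, ‖h p‖ ^ 2 * (if dist (p : (EuclideanSpace ℝ (Fin 3))) c ≤ R + ρ then (1 : ℝ) else 0)) +
      38 * (1024 / ((23 / 25 : ℝ) ^ 3 * ρ ^ 5)) * B ^ 2 * (2 * R / (23 / 25) + 1) ^ 3 := by
  classical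
  have hB0 : 0 ≤ B := (norm_nonneg _).trans (hB 0)
  have hρ0 : 0 < ρ := by linarith
  have hρ' : (23 / 25 : ℝ) ≤ ρ := by linarith
  -- the four weight families
  have hWn : Summable (Function.uncurry fun (p q : Sites₀ t A) => (if (p : (EuclideanSpace ℝ (Fin 3))) ≠ q then (dist (p : (EuclideanSpace ℝ (Fin 3))) q)⁻¹ ^ 6 * (‖h q‖ ^ 2 * (if dist (q : (EuclideanSpace ℝ (Fin 3))) c ≤ R + ρ then (1 : ℝ) else 0)) else 0)) := summable_nearWeight hA hI hh c R ρ
  have hWn' : Summable (Function.uncurry fun (p q : Sites₀ t A) => (if (q : (EuclideanSpace ℝ (Fin 3))) ≠ p then (dist (q : (EuclideanSpace ℝ (Fin 3))) p)⁻¹ ^ 6 * (‖h p‖ ^ 2 * (if dist (p : (EuclideanSpace ℝ (Fin 3))) c ≤ R + ρ then (1 : ℝ) else 0)) else 0)) := by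
    refine hWn.prod_symm.congr fun pq => ?_
    obtain ⟨p, q⟩ := pq
    simp only [Prod.swap_prod_mk, Function.uncurry_apply_pair]
  have hWf : Summable (Function.uncurry fun (p q : Sites₀ t A) => (if (p : (EuclideanSpace ℝ (Fin 3))) ≠ q then (if ρ < dist (p : (EuclideanSpace ℝ (Fin 3))) q then (dist (p : (EuclideanSpace ℝ (Fin 3))) q)⁻¹ ^ 8 else 0) * (if dist (p : (EuclideanSpace ℝ (Fin 3))) c ≤ R then (1 : ℝ) else 0) else 0)) := summable_farWeight hA hI c R hρ'
  have hWf' : Summable (Function.uncurry fun (p q : Sites₀ t A) => (if (q : (EuclideanSpace ℝ (Fin 3))) ≠ p then (if ρ < dist (q : (EuclideanSpace ℝ (Fin 3))) p then (dist (q : (EuclideanSpace ℝ (Fin 3))) p)⁻¹ ^ 8 else 0) * (if dist (q : (EuclideanSpace ℝ (Fin 3))) c ≤ R then (1 : ℝ) else 0) else 0)) := by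
    refine hWf.prod_symm.congr fun pq => ?_
    obtain ⟨p, q⟩ := pq
    simp only [Prod.swap_prod_mk, Function.uncurry_apply_pair]
  -- the majorant is summable and dominates the terms
  have hmaj : Summable (Function.uncurry fun (p q : Sites₀ t A) =>
      19 / ρ ^ 2 * ((if (p : (EuclideanSpace ℝ (Fin 3))) ≠ q then (dist (p : (EuclideanSpace ℝ (Fin 3))) q)⁻¹ ^ 6 * (‖h q‖ ^ 2 * (if dist (q : (EuclideanSpace ℝ (Fin 3))) c ≤ R + ρ then (1 : ℝ) else 0)) else 0) + (if (q : (EuclideanSpace ℝ (Fin 3))) ≠ p then (dist (q : (EuclideanSpace ℝ (Fin 3))) p)⁻¹ ^ 6 * (‖h p‖ ^ 2 * (if dist (p : (EuclideanSpace ℝ (Fin 3))) c ≤ R + ρ then (1 : ℝ) else 0)) else 0)) + 38 * B ^ 2 * ((if (p : (EuclideanSpace ℝ (Fin 3))) ≠ q then (if ρ < dist (p : (EuclideanSpace ℝ (Fin 3))) q then (dist (p : (EuclideanSpace ℝ (Fin 3))) q)⁻¹ ^ 8 else 0) * (if dist (p : (EuclideanSpace ℝ (Fin 3))) c ≤ R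 then (1 : ℝ) else 0) else 0) + (if (q : (EuclideanSpace ℝ (Fin 3))) ≠ p then (if ρ < dist (q : (EuclideanSpace ℝ (Fin 3))) p then (dist (q : (EuclideanSpace ℝ (Fin 3))) p)⁻¹ ^ 8 else 0) * (if dist (q : (EuclideanSpace ℝ (Fin 3))) c ≤ R then (1 : ℝ) else 0) else 0))) := by
    have := ((hWn.add hWn').mul_left (19 / ρ ^ 2)).add ((hWf.add hWf').mul_left (38 * B ^ 2))
    refine this.congr fun pq => ?_
    obtain ⟨p, q⟩ := pq
    simp only [Function.uncurry_apply_pair]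
  have hterm : ∀ p q : Sites₀ t A, |(if (p : (EuclideanSpace ℝ (Fin 3))) ≠ q then (η p - η q) ^ 2 * ⟪((-((‖(p : (EuclideanSpace ℝ (Fin 3))) - q‖ ^ 2)⁻¹) ^ 7 + ((‖(p : (EuclideanSpace ℝ (Fin 3))) - q‖ ^ 2)⁻¹) ^ 4) • (h p) + (2 * ⟪(p : (EuclideanSpace ℝ (Fin 3))) - q, h p⟫ * (7 * ((‖(p : (EuclideanSpace ℝ (Fin 3))) - q‖ ^ 2)⁻¹) ^ 8 - 4 * ((‖(p : (EuclideanSpace ℝ (Fin 3))) - q‖ ^ 2)⁻¹) ^ 5)) • ((p : (EuclideanSpace ℝ (Fin 3))) - q)), h q⟫ else 0)| ≤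
      19 / ρ ^ 2 * ((if (p : (EuclideanSpace ℝ (Fin 3))) ≠ q then (dist (p : (EuclideanSpace ℝ (Fin 3))) q)⁻¹ ^ 6 * (‖h q‖ ^ 2 * (if dist (q : (EuclideanSpace ℝ (Fin 3))) c ≤ R + ρ then (1 : ℝ) else 0)) else 0) + (if (q : (EuclideanSpace ℝ (Fin 3))) ≠ p then (dist (q : (EuclideanSpace ℝ (Fin 3))) p)⁻¹ ^ 6 * (‖h p‖ ^ 2 * (if dist (p : (EuclideanSpace ℝ (Fin 3))) c ≤ R + ρ then (1 : ℝ) else 0)) else 0)) + 38 * B ^ 2 * ((if (p : (EuclideanSpace ℝ (Fin 3))) ≠ q then (if ρ < dist (p : (EuclideanSpace ℝ (Fin 3))) q then (dist (p : (EuclideanSpace ℝ (Fin 3))) q)⁻¹ ^ 8 else 0) * (if dist (p : (EuclideanSpace ℝ (Fin 3))) c ≤ R then (1 : ℝ) else 0) else 0) + (if (q : (EuclideanSpace ℝ (Fin 3))) ≠ p then (if ρ < dist (q : (EuclideanSpace ℝ (Fin 3))) p then (dist (q : (EuclideanSpace ℝ (Fin 3))) p)⁻¹ ^ 8 else 0)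 * (if dist (q : (EuclideanSpace ℝ (Fin 3))) c ≤ R then (1 : ℝ) else 0) else 0)) :=
    fun p q => cutoffTerm_le_local hA hI hB hη0 hη1 hρ hηR hlip p q
  have hXs : Summable (Function.uncurry fun (p q : Sites₀ t A) => (if (p : (EuclideanSpace ℝ (Fin 3))) ≠ q then (η p - η q) ^ 2 * ⟪((-((‖(p : (EuclideanSpace ℝ (Fin 3))) - q‖ ^ 2)⁻¹) ^ 7 + ((‖(p : (EuclideanSpace ℝ (Fin 3))) - q‖ ^ 2)⁻¹) ^ 4) • (h p) + (2 * ⟪(p : (EuclideanSpace ℝ (Fin 3))) - q, h p⟫ * (7 * ((‖(p : (EuclideanSpace ℝ (Fin 3))) - q‖ ^ 2)⁻¹) ^ 8 - 4 * ((‖(p : (EuclideanSpace ℝ (Fin 3))) - q‖ ^ 2)⁻¹) ^ 5)) • ((p : (EuclideanSpace ℝ (Fin 3))) - q)), h q⟫ else 0)) := by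
    refine Summable.of_norm_bounded hmaj fun pq => ?_
    obtain ⟨p, q⟩ := pq
    rw [Real.norm_eq_abs]
    exact hterm p q
  -- ‖Σ'Σ' Ξ‖ ≤ Σ'Σ' M
  have hrowle : ∀ p : Sites₀ t A, ‖∑' q : Sites₀ t A, (if (p : (EuclideanSpace ℝ (Fin 3))) ≠ q then (η p - η q) ^ 2 * ⟪((-((‖(p : (EuclideanSpace ℝ (Fin 3))) - q‖ ^ 2)⁻¹) ^ 7 + ((‖(p : (EuclideanSpace ℝ (Fin 3))) - q‖ ^ 2)⁻¹) ^ 4) • (h p) + (2 * ⟪(p : (EuclideanSpace ℝ (Fin 3))) - q, h p⟫ * (7 * ((‖(p : (EuclideanSpace ℝ (Fin 3))) - q‖ ^ 2)⁻¹) ^ 8 - 4 * ((‖(p : (EuclideanSpace ℝ (Fin 3))) - q‖ ^ 2)⁻¹) ^ 5)) • ((p : (EuclideanSpace ℝ (Fin 3))) - q)), h q⟫ else 0)‖ ≤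
      ∑' q : Sites₀ t A, (19 / ρ ^ 2 * ((if (p : (EuclideanSpace ℝ (Fin 3))) ≠ q then (dist (p : (EuclideanSpace ℝ (Fin 3))) q)⁻¹ ^ 6 * (‖h q‖ ^ 2 * (if dist (q : (EuclideanSpace ℝ (Fin 3))) c ≤ R + ρ then (1 : ℝ) else 0)) else 0) + (if (q : (EuclideanSpace ℝ (Fin 3))) ≠ p then (dist (q : (EuclideanSpace ℝ (Fin 3))) p)⁻¹ ^ 6 * (‖h p‖ ^ 2 * (if dist (p : (EuclideanSpace ℝ (Fin 3))) c ≤ R + ρ then (1 : ℝ) else 0)) else 0)) + 38 * B ^ 2 * ((if (p : (EuclideanSpace ℝ (Fin 3))) ≠ q then (if ρ < dist (p : (EuclideanSpace ℝ (Fin 3))) q then (dist (p : (EuclideanSpace ℝ (Fin 3))) q)⁻¹ ^ 8 else 0) * (if dist (p : (EuclideanSpace ℝ (Fin 3))) c ≤ R then (1 : ℝ) else 0) else 0) + (if (q : (EuclideanSpace ℝ (Fin 3))) ≠ p then (if ρ < dist (q : (EuclideanSpace ℝ (Fin 3))) p then (dist (q : (EuclideanSpace ℝ (Fin 3))) p)⁻¹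 ^ 8 else 0) * (if dist (q : (EuclideanSpace ℝ (Fin 3))) c ≤ R then (1 : ℝ) else 0) else 0))) := by
    intro p
    have hr : Summable (fun q : Sites₀ t A => (if (p : (EuclideanSpace ℝ (Fin 3))) ≠ q then (η p - η q) ^ 2 * ⟪((-((‖(p : (EuclideanSpace ℝ (Fin 3))) - q‖ ^ 2)⁻¹) ^ 7 + ((‖(p : (EuclideanSpace ℝ (Fin 3))) - q‖ ^ 2)⁻¹) ^ 4) • (h p) + (2 * ⟪(p : (EuclideanSpace ℝ (Fin 3))) - q, h p⟫ * (7 * ((‖(p : (EuclideanSpace ℝ (Fin 3))) - q‖ ^ 2)⁻¹) ^ 8 - 4 * ((‖(p : (EuclideanSpace ℝ (Fin 3))) - q‖ ^ 2)⁻¹) ^ 5)) • ((p : (EuclideanSpace ℝ (Fin 3))) - q)), h q⟫ else 0)) := hXs.prod_factor p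
    have hm : Summable (fun q : Sites₀ t A =>
        (19 / ρ ^ 2 * ((if (p : (EuclideanSpace ℝ (Fin 3))) ≠ q then (dist (p : (EuclideanSpace ℝ (Fin 3))) q)⁻¹ ^ 6 * (‖h q‖ ^ 2 * (if dist (q : (EuclideanSpace ℝ (Fin 3))) c ≤ R + ρ then (1 : ℝ) else 0)) else 0) + (if (q : (EuclideanSpace ℝ (Fin 3))) ≠ p then (dist (q : (EuclideanSpace ℝ (Fin 3))) p)⁻¹ ^ 6 * (‖h p‖ ^ 2 * (if dist (p : (EuclideanSpace ℝ (Fin 3))) c ≤ R + ρ then (1 : ℝ) else 0)) else 0)) + 38 * B ^ 2 * ((if (p : (EuclideanSpace ℝ (Fin 3))) ≠ q then (if ρ < dist (p : (EuclideanSpace ℝ (Fin 3))) q then (dist (p : (EuclideanSpace ℝ (Fin 3))) q)⁻¹ ^ 8 else 0) * (if dist (p : (EuclideanSpace ℝ (Fin 3))) c ≤ R then (1 : ℝ) else 0) else 0) + (if (q : (EuclideanSpace ℝ (Fin 3))) ≠ p then (if ρ < dist (q : (EuclideanSpace ℝ (Fin 3))) p then (dist (q : (EuclideanSpace ℝ (Fin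 3))) p)⁻¹ ^ 8 else 0) * (if dist (q : (EuclideanSpace ℝ (Fin 3))) c ≤ R then (1 : ℝ) else 0) else 0)))) := hmaj.prod_factor p
    refine (norm_tsum_le_tsum_norm hr.norm).trans (hr.norm.tsum_le_tsum (fun q => ?_) hm)
    rw [Real.norm_eq_abs]
    exact hterm p q
  have hout : Summable (fun p : Sites₀ t A => ∑' q : Sites₀ t A, (if (p : (EuclideanSpace ℝ (Fin 3))) ≠ q then (η p - η q) ^ 2 * ⟪((-((‖(p : (EuclideanSpace ℝ (Fin 3))) - q‖ ^ 2)⁻¹) ^ 7 + ((‖(p : (EuclideanSpace ℝ (Fin 3))) - q‖ ^ 2)⁻¹) ^ 4) • (h p) + (2 * ⟪(p : (EuclideanSpace ℝ (Fin 3))) - q, h p⟫ * (7 * ((‖(p : (EuclideanSpace ℝ (Fin 3))) - q‖ ^ 2)⁻¹) ^ 8 - 4 * ((‖(p : (EuclideanSpace ℝ (Fin 3))) - q‖ ^ 2)⁻¹) ^ 5)) • ((p : (EuclideanSpace ℝ (Fin 3))) - q)), h q⟫ else 0)) := hXs.prod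
  have houtM : Summable (fun p : Sites₀ t A => ∑' q : Sites₀ t A,
      (19 / ρ ^ 2 * ((if (p : (EuclideanSpace ℝ (Fin 3))) ≠ q then (dist (p : (EuclideanSpace ℝ (Fin 3))) q)⁻¹ ^ 6 * (‖h q‖ ^ 2 * (if dist (q : (EuclideanSpace ℝ (Fin 3))) c ≤ R + ρ then (1 : ℝ) else 0)) else 0) + (if (q : (EuclideanSpace ℝ (Fin 3))) ≠ p then (dist (q : (EuclideanSpace ℝ (Fin 3))) p)⁻¹ ^ 6 * (‖h p‖ ^ 2 * (if dist (p : (EuclideanSpace ℝ (Fin 3))) c ≤ R + ρ then (1 : ℝ) else 0)) else 0)) + 38 * B ^ 2 * ((if (p : (EuclideanSpace ℝ (Fin 3))) ≠ q then (if ρ < dist (p : (EuclideanSpace ℝ (Fin 3))) q then (dist (p : (EuclideanSpace ℝ (Fin 3))) q)⁻¹ ^ 8 else 0) * (if dist (p : (EuclideanSpace ℝ (Fin 3))) c ≤ R then (1 : ℝ) else 0) else 0) + (if (q : (EuclideanSpace ℝ (Fin 3))) ≠ p then (if ρ < dist (q : (EuclideanSpace ℝ (Fin 3))) p then (dist (q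 : (EuclideanSpace ℝ (Fin 3))) p)⁻¹ ^ 8 else 0) * (if dist (q : (EuclideanSpace ℝ (Fin 3))) c ≤ R then (1 : ℝ) else 0) else 0)))) := hmaj.prod
  have h1 : ‖∑' p : Sites₀ t A, ∑' q : Sites₀ t A, (if (p : (EuclideanSpace ℝ (Fin 3))) ≠ q then (η p - η q) ^ 2 * ⟪((-((‖(p : (EuclideanSpace ℝ (Fin 3))) - q‖ ^ 2)⁻¹) ^ 7 + ((‖(p : (EuclideanSpace ℝ (Fin 3))) - q‖ ^ 2)⁻¹) ^ 4) • (h p) + (2 * ⟪(p : (EuclideanSpace ℝ (Fin 3))) - q, h p⟫ * (7 * ((‖(p : (EuclideanSpace ℝ (Fin 3))) - q‖ ^ 2)⁻¹) ^ 8 - 4 * ((‖(p : (EuclideanSpace ℝ (Fin 3))) - q‖ ^ 2)⁻¹) ^ 5)) • ((p : (EuclideanSpace ℝ (Fin 3))) - q)), h q⟫ else 0)‖ ≤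
      ∑' p : Sites₀ t A, ∑' q : Sites₀ t A,
        (19 / ρ ^ 2 * ((if (p : (EuclideanSpace ℝ (Fin 3))) ≠ q then (dist (p : (EuclideanSpace ℝ (Fin 3))) q)⁻¹ ^ 6 * (‖h q‖ ^ 2 * (if dist (q : (EuclideanSpace ℝ (Fin 3))) c ≤ R + ρ then (1 : ℝ) else 0)) else 0) + (if (q : (EuclideanSpace ℝ (Fin 3))) ≠ p then (dist (q : (EuclideanSpace ℝ (Fin 3))) p)⁻¹ ^ 6 * (‖h p‖ ^ 2 * (if dist (p : (EuclideanSpace ℝ (Fin 3))) c ≤ R + ρ then (1 : ℝ) else 0)) else 0)) + 38 * B ^ 2 * ((if (p : (EuclideanSpace ℝ (Fin 3))) ≠ q then (if ρ < dist (p : (EuclideanSpace ℝ (Fin 3))) q then (dist (p : (EuclideanSpace ℝ (Fin 3))) q)⁻¹ ^ 8 else 0) * (if dist (p : (EuclideanSpace ℝ (Fin 3))) c ≤ R then (1 : ℝ) else 0) else 0) + (if (q : (EuclideanSpace ℝ (Fin 3))) ≠ p then (if ρ < dist (q : (EuclideanSpace ℝ (Fin 3))) p then (dist (q : (EuclideanSpace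 ℝ (Fin 3))) p)⁻¹ ^ 8 else 0) * (if dist (q : (EuclideanSpace ℝ (Fin 3))) c ≤ R then (1 : ℝ) else 0) else 0))) :=
    (norm_tsum_le_tsum_norm hout.norm).trans (hout.norm.tsum_le_tsum hrowle houtM)
  -- split Σ'Σ' M into the four pieces
  have hWn_out : Summable (fun p : Sites₀ t A => ∑' q : Sites₀ t A, (if (p : (EuclideanSpace ℝ (Fin 3))) ≠ q then (dist (p : (EuclideanSpace ℝ (Fin 3))) q)⁻¹ ^ 6 * (‖h q‖ ^ 2 * (if dist (q : (EuclideanSpace ℝ (Fin 3))) c ≤ R + ρ then (1 : ℝ) else 0)) else 0)) := hWn.prod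
  have hWn'_out : Summable (fun p : Sites₀ t A => ∑' q : Sites₀ t A, (if (q : (EuclideanSpace ℝ (Fin 3))) ≠ p then (dist (q : (EuclideanSpace ℝ (Fin 3))) p)⁻¹ ^ 6 * (‖h p‖ ^ 2 * (if dist (p : (EuclideanSpace ℝ (Fin 3))) c ≤ R + ρ then (1 : ℝ) else 0)) else 0)) := hWn'.prod
  have hWf_out : Summable (fun p : Sites₀ t A => ∑' q : Sites₀ t A, (if (p : (EuclideanSpace ℝ (Fin 3))) ≠ q then (if ρ < dist (p : (EuclideanSpace ℝ (Fin 3))) q then (dist (p : (EuclideanSpace ℝ (Fin 3))) q)⁻¹ ^ 8 else 0) * (if dist (p : (EuclideanSpace ℝ (Fin 3))) c ≤ R then (1 : ℝ) else 0) else 0)) := hWf.prod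
  have hWf'_out : Summable (fun p : Sites₀ t A => ∑' q : Sites₀ t A, (if (q : (EuclideanSpace ℝ (Fin 3))) ≠ p then (if ρ < dist (q : (EuclideanSpace ℝ (Fin 3))) p then (dist (q : (EuclideanSpace ℝ (Fin 3))) p)⁻¹ ^ 8 else 0) * (if dist (q : (EuclideanSpace ℝ (Fin 3))) c ≤ R then (1 : ℝ) else 0) else 0)) := hWf'.prod
  have hWn_r : ∀ p : Sites₀ t A, Summable (fun q : Sites₀ t A => (if (p : (EuclideanSpace ℝ (Fin 3))) ≠ q then (dist (p : (EuclideanSpace ℝ (Fin 3))) q)⁻¹ ^ 6 * (‖h q‖ ^ 2 * (if dist (q : (EuclideanSpace ℝ (Fin 3))) c ≤ R + ρ then (1 : ℝ) else 0)) else 0)) := fun p => hWn.prod_factor p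
  have hWn'_r : ∀ p : Sites₀ t A, Summable (fun q : Sites₀ t A => (if (q : (EuclideanSpace ℝ (Fin 3))) ≠ p then (dist (q : (EuclideanSpace ℝ (Fin 3))) p)⁻¹ ^ 6 * (‖h p‖ ^ 2 * (if dist (p : (EuclideanSpace ℝ (Fin 3))) c ≤ R + ρ then (1 : ℝ) else 0)) else 0)) := fun p => hWn'.prod_factor p
  have hWf_r : ∀ p : Sites₀ t A, Summable (fun q : Sites₀ t A => (if (p : (EuclideanSpace ℝ (Fin 3))) ≠ q then (if ρ < dist (p : (EuclideanSpace ℝ (Fin 3))) q then (dist (p : (EuclideanSpace ℝ (Fin 3))) q)⁻¹ ^ 8 else 0) * (if dist (p : (EuclideanSpace ℝ (Fin 3))) c ≤ R then (1 : ℝ) else 0) else 0)) := fun p => hWf.prod_factor p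
  have hWf'_r : ∀ p : Sites₀ t A, Summable (fun q : Sites₀ t A => (if (q : (EuclideanSpace ℝ (Fin 3))) ≠ p then (if ρ < dist (q : (EuclideanSpace ℝ (Fin 3))) p then (dist (q : (EuclideanSpace ℝ (Fin 3))) p)⁻¹ ^ 8 else 0) * (if dist (q : (EuclideanSpace ℝ (Fin 3))) c ≤ R then (1 : ℝ) else 0) else 0)) := fun p => hWf'.prod_factor p
  have hrowM : ∀ p : Sites₀ t A, (∑' q : Sites₀ t A,
      (19 / ρ ^ 2 * ((if (p : (EuclideanSpace ℝ (Fin 3))) ≠ q then (dist (p : (EuclideanSpace ℝ (Fin 3))) q)⁻¹ ^ 6 * (‖h q‖ ^ 2 * (if dist (q : (EuclideanSpace ℝ (Fin 3))) c ≤ R + ρ then (1 : ℝ) else 0)) else 0) + (if (q : (EuclideanSpace ℝ (Fin 3))) ≠ p then (dist (q : (EuclideanSpace ℝ (Fin 3))) p)⁻¹ ^ 6 * (‖h p‖ ^ 2 * (if dist (p : (EuclideanSpace ℝ (Fin 3))) c ≤ R + ρ then (1 : ℝ) else 0)) else 0)) + 38 * B ^ 2 * ((if (p : (EuclideanSpace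 ℝ (Fin 3))) ≠ q then (if ρ < dist (p : (EuclideanSpace ℝ (Fin 3))) q then (dist (p : (EuclideanSpace ℝ (Fin 3))) q)⁻¹ ^ 8 else 0) * (if dist (p : (EuclideanSpace ℝ (Fin 3))) c ≤ R then (1 : ℝ) else 0) else 0) + (if (q : (EuclideanSpace ℝ (Fin 3))) ≠ p then (if ρ < dist (q : (EuclideanSpace ℝ (Fin 3))) p then (dist (q : (EuclideanSpace ℝ (Fin 3))) p)⁻¹ ^ 8 else 0) * (if dist (q : (EuclideanSpace ℝ (Fin 3))) c ≤ R then (1 : ℝ) else 0) else 0)))) =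
      19 / ρ ^ 2 * ((∑' q : Sites₀ t A, (if (p : (EuclideanSpace ℝ (Fin 3))) ≠ q then (dist (p : (EuclideanSpace ℝ (Fin 3))) q)⁻¹ ^ 6 * (‖h q‖ ^ 2 * (if dist (q : (EuclideanSpace ℝ (Fin 3))) c ≤ R + ρ then (1 : ℝ) else 0)) else 0)) + ∑' q : Sites₀ t A, (if (q : (EuclideanSpace ℝ (Fin 3))) ≠ p then (dist (q : (EuclideanSpace ℝ (Fin 3))) p)⁻¹ ^ 6 * (‖h p‖ ^ 2 * (if dist (p : (EuclideanSpace ℝ (Fin 3))) c ≤ R + ρ then (1 : ℝ) else 0)) else 0)) +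
      38 * B ^ 2 * ((∑' q : Sites₀ t A, (if (p : (EuclideanSpace ℝ (Fin 3))) ≠ q then (if ρ < dist (p : (EuclideanSpace ℝ (Fin 3))) q then (dist (p : (EuclideanSpace ℝ (Fin 3))) q)⁻¹ ^ 8 else 0) * (if dist (p : (EuclideanSpace ℝ (Fin 3))) c ≤ R then (1 : ℝ) else 0) else 0)) + ∑' q : Sites₀ t A, (if (q : (EuclideanSpace ℝ (Fin 3))) ≠ p then (if ρ < dist (q : (EuclideanSpace ℝ (Fin 3))) p then (dist (q : (EuclideanSpace ℝ (Fin 3))) p)⁻¹ ^ 8 else 0) * (if dist (q : (EuclideanSpace ℝ (Fin 3))) c ≤ R then (1 : ℝ) else 0) else 0)) := by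
    intro p
    have hs1 : Summable (fun q : Sites₀ t A => 19 / ρ ^ 2 * ((if (p : (EuclideanSpace ℝ (Fin 3))) ≠ q then (dist (p : (EuclideanSpace ℝ (Fin 3))) q)⁻¹ ^ 6 * (‖h q‖ ^ 2 * (if dist (q : (EuclideanSpace ℝ (Fin 3))) c ≤ R + ρ then (1 : ℝ) else 0)) else 0) + (if (q : (EuclideanSpace ℝ (Fin 3))) ≠ p then (dist (q : (EuclideanSpace ℝ (Fin 3))) p)⁻¹ ^ 6 * (‖h p‖ ^ 2 * (if dist (p : (EuclideanSpace ℝ (Fin 3))) c ≤ R + ρ then (1 : ℝ) else 0)) else 0))) :=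
      (((hWn_r p).add (hWn'_r p)).mul_left (19 / ρ ^ 2)).congr fun q => rfl
    have hs2 : Summable (fun q : Sites₀ t A => 38 * B ^ 2 * ((if (p : (EuclideanSpace ℝ (Fin 3))) ≠ q then (if ρ < dist (p : (EuclideanSpace ℝ (Fin 3))) q then (dist (p : (EuclideanSpace ℝ (Fin 3))) q)⁻¹ ^ 8 else 0) * (if dist (p : (EuclideanSpace ℝ (Fin 3))) c ≤ R then (1 : ℝ) else 0) else 0) + (if (q : (EuclideanSpace ℝ (Fin 3))) ≠ p then (if ρ < dist (q : (EuclideanSpace ℝ (Fin 3))) p then (dist (q : (EuclideanSpace ℝ (Fin 3))) p)⁻¹ ^ 8 else 0) * (if dist (q : (EuclideanSpace ℝ (Fin 3))) c ≤ R then (1 : ℝ) else 0) else 0))) :=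
      (((hWf_r p).add (hWf'_r p)).mul_left (38 * B ^ 2)).congr fun q => rfl
    rw [hs1.tsum_add hs2, tsum_mul_left, tsum_mul_left, (hWn_r p).tsum_add (hWn'_r p),
      (hWf_r p).tsum_add (hWf'_r p)]
  have hMsum : (∑' p : Sites₀ t A, ∑' q : Sites₀ t A,
      (19 / ρ ^ 2 * ((if (p : (EuclideanSpace ℝ (Fin 3))) ≠ q then (dist (p : (EuclideanSpace ℝ (Fin 3))) q)⁻¹ ^ 6 * (‖h q‖ ^ 2 * (if dist (q : (EuclideanSpace ℝ (Fin 3))) c ≤ R + ρ then (1 : ℝ) else 0)) else 0) + (if (q : (EuclideanSpace ℝ (Fin 3))) ≠ p then (dist (q : (EuclideanSpace ℝ (Fin 3))) p)⁻¹ ^ 6 * (‖h p‖ ^ 2 * (if dist (p : (EuclideanSpace ℝ (Fin 3))) c ≤ R + ρ then (1 : ℝ) else 0)) else 0)) + 38 * B ^ 2 * ((if (p : (EuclideanSpace ℝ (Fin 3))) ≠ q then (if ρ < dist (p : (EuclideanSpace ℝ (Fin 3))) q then (dist (p : (EuclideanSpace ℝ (Fin 3))) q)⁻¹ ^ 8 else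 0) * (if dist (p : (EuclideanSpace ℝ (Fin 3))) c ≤ R then (1 : ℝ) else 0) else 0) + (if (q : (EuclideanSpace ℝ (Fin 3))) ≠ p then (if ρ < dist (q : (EuclideanSpace ℝ (Fin 3))) p then (dist (q : (EuclideanSpace ℝ (Fin 3))) p)⁻¹ ^ 8 else 0) * (if dist (q : (EuclideanSpace ℝ (Fin 3))) c ≤ R then (1 : ℝ) else 0) else 0)))) =
      19 / ρ ^ 2 * ((∑' p : Sites₀ t A, ∑' q : Sites₀ t A, (if (p : (EuclideanSpace ℝ (Fin 3))) ≠ q then (dist (p : (EuclideanSpace ℝ (Fin 3))) q)⁻¹ ^ 6 * (‖h q‖ ^ 2 * (if dist (q : (EuclideanSpace ℝ (Fin 3))) c ≤ R + ρ then (1 : ℝ) else 0)) else 0)) + ∑' p : Sites₀ t A, ∑' q : Sites₀ t A, (if (q : (EuclideanSpace ℝ (Fin 3))) ≠ p then (dist (q : (EuclideanSpace ℝ (Fin 3))) p)⁻¹ ^ 6 * (‖h p‖ ^ 2 * (if dist (p : (EuclideanSpace ℝ (Fin 3))) c ≤ R + ρ then (1 : ℝ) else 0)) else 0)) +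
      38 * B ^ 2 * ((∑' p : Sites₀ t A, ∑' q : Sites₀ t A, (if (p : (EuclideanSpace ℝ (Fin 3))) ≠ q then (if ρ < dist (p : (EuclideanSpace ℝ (Fin 3))) q then (dist (p : (EuclideanSpace ℝ (Fin 3))) q)⁻¹ ^ 8 else 0) * (if dist (p : (EuclideanSpace ℝ (Fin 3))) c ≤ R then (1 : ℝ) else 0) else 0)) + ∑' p : Sites₀ t A, ∑' q : Sites₀ t A, (if (q : (EuclideanSpace ℝ (Fin 3))) ≠ p then (if ρ < dist (q : (EuclideanSpace ℝ (Fin 3))) p then (dist (q : (EuclideanSpace ℝ (Fin 3))) p)⁻¹ ^ 8 else 0) * (if dist (q : (EuclideanSpace ℝ (Fin 3))) c ≤ R then (1 : ℝ) else 0) else 0)) := by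
    rw [tsum_congr hrowM]
    have hs1 : Summable (fun p : Sites₀ t A =>
        19 / ρ ^ 2 * ((∑' q : Sites₀ t A, (if (p : (EuclideanSpace ℝ (Fin 3))) ≠ q then (dist (p : (EuclideanSpace ℝ (Fin 3))) q)⁻¹ ^ 6 * (‖h q‖ ^ 2 * (if dist (q : (EuclideanSpace ℝ (Fin 3))) c ≤ R + ρ then (1 : ℝ) else 0)) else 0)) + ∑' q : Sites₀ t A, (if (q : (EuclideanSpace ℝ (Fin 3))) ≠ p then (dist (q : (EuclideanSpace ℝ (Fin 3))) p)⁻¹ ^ 6 * (‖h p‖ ^ 2 * (if dist (p : (EuclideanSpace ℝ (Fin 3))) c ≤ R + ρ then (1 : ℝ) else 0)) else 0))) :=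
      ((hWn_out.add hWn'_out).mul_left (19 / ρ ^ 2)).congr fun p => rfl
    have hs2 : Summable (fun p : Sites₀ t A =>
        38 * B ^ 2 * ((∑' q : Sites₀ t A, (if (p : (EuclideanSpace ℝ (Fin 3))) ≠ q then (if ρ < dist (p : (EuclideanSpace ℝ (Fin 3))) q then (dist (p : (EuclideanSpace ℝ (Fin 3))) q)⁻¹ ^ 8 else 0) * (if dist (p : (EuclideanSpace ℝ (Fin 3))) c ≤ R then (1 : ℝ) else 0) else 0)) + ∑' q : Sites₀ t A, (if (q : (EuclideanSpace ℝ (Fin 3))) ≠ p then (if ρ < dist (q : (EuclideanSpace ℝ (Fin 3))) p then (dist (q : (EuclideanSpace ℝ (Fin 3))) p)⁻¹ ^ 8 else 0) * (if dist (q : (EuclideanSpace ℝ (Fin 3))) c ≤ R then (1 : ℝ) else 0) else 0))) :=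
      ((hWf_out.add hWf'_out).mul_left (38 * B ^ 2)).congr fun p => rfl
    rw [hs1.tsum_add hs2, tsum_mul_left, tsum_mul_left, hWn_out.tsum_add hWn'_out, hWf_out.tsum_add hWf'_out]
  -- the four bounds
  have hA1 := tsum_tsum_nearWeight'_le hA hI hh c R ρ
  have hA2 := tsum_tsum_nearWeight_le hA hI hh c R ρ
  have hA3 := tsum_tsum_farWeight_le hA hI c hR hρ'
  have hA4 := tsum_tsum_farWeight'_le hA hI c hR hρ'
  -- conclude
  rw [abs_mul, abs_of_pos (by norm_num : (0 : ℝ) < 1 / 2), ← Real.norm_eq_abs]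
  have h2 := h1.trans (le_of_eq hMsum)
  have hS0 : 0 ≤ ∑' p : Sites₀ t A, ‖h p‖ ^ 2 * (if dist (p : (EuclideanSpace ℝ (Fin 3))) c ≤ R + ρ then (1 : ℝ) else 0) :=
    tsum_nonneg fun p => by split_ifs <;> positivity
  have hρ2 : 0 < ρ ^ 2 := by positivity
  have hP0 : 0 ≤ (2 * R / (23 / 25) + 1) ^ 3 := by positivity
  have hB2 : 0 ≤ B ^ 2 := sq_nonneg _
  have hc1 : 0 ≤ 19 / ρ ^ 2 := by positivity
  have hc2 : 0 ≤ 38 * B ^ 2 := by positivity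
  have hsumN := add_le_add hA2 hA1
  have hsumF := add_le_add hA3 hA4
  have e1 := mul_le_mul_of_nonneg_left hsumN hc1
  have e2 := mul_le_mul_of_nonneg_left hsumF hc2
  have h3 := h2.trans (add_le_add e1 e2)
  have hfinal : (1 / 2 : ℝ) * (19 / ρ ^ 2 * ((1024 / ((23 / 25 : ℝ) ^ 3 * (23 / 25 : ℝ) ^ 3)) * (∑' q : Sites₀ t A, ‖h q‖ ^ 2 * (if dist (q : (EuclideanSpace ℝ (Fin 3))) c ≤ R + ρ then (1 : ℝ) else 0)) +
        (1024 / ((23 / 25 : ℝ) ^ 3 * (23 / 25 : ℝ) ^ 3)) * ∑' p : Sites₀ t A, ‖h p‖ ^ 2 * (if dist (p : (EuclideanSpace ℝ (Fin 3))) c ≤ R + ρ then (1 : ℝ) else 0)) +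
      38 * B ^ 2 * (1024 / ((23 / 25 : ℝ) ^ 3 * ρ ^ 5) * (2 * R / (23 / 25) + 1) ^ 3 +
        1024 / ((23 / 25 : ℝ) ^ 3 * ρ ^ 5) * (2 * R / (23 / 25) + 1) ^ 3)) =
      19 * (1024 / ((23 / 25 : ℝ) ^ 3 * (23 / 25 : ℝ) ^ 3)) / ρ ^ 2 * (∑' p : Sites₀ t A, ‖h p‖ ^ 2 * (if dist (p : (EuclideanSpace ℝ (Fin 3))) c ≤ R + ρ then (1 : ℝ) else 0)) +
      38 * (1024 / ((23 / 25 : ℝ) ^ 3 * ρ ^ 5)) * B ^ 2 * (2 * R / (23 / 25) + 1) ^ 3 := by ring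
  rw [← hfinal]
  exact mul_le_mul_of_nonneg_left h3 (by norm_num)

end

end Summit.AtomisticToContinuum.Crystallization.Theorems.ExcessDecayLiouville

end
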